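import Summits.CriticalPhenomena.PercolationContinuityZ3.Theorems.PercNearOneGluingNoHeavyQuantFarGate3BoxCover
import HarnessLib

/-!
# QUANT lane R8, front "FAR beyond trees", layer one — THE DEGREE-THREE GATE AT THE OBSERVER, LII: E-FREE coverage of the `σ`-chart —
# k-d trees whose leaves are single `E`-free box certificates with window start at most `S`, and the coverage theorem `BoxCoverE.treeE_sound`

builds on p205010 (kernel theorem, internal audit signed; external expert review pending)

Support file (`--supports stmt-CriticalPhenomena-4575`), seat `prim-quant-p1` (gen 33; the gen-32 original of this file was lost with its session
folder and is re-generated here by `work/chartc/gen_covere.py`); memo `run/shared/lean/prim/quant/prim-quant-p1-g32/FOR-LEAD-GATE3-CHARTC.md` §3.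
Mathlib-only + files XLI–XLV; standard axioms; no sorries.

THE LARGE-`σ` HALF OF THE TWO-CHART ARCHITECTURE.  An `E`-free certificate (`Cert.efree = true`, file XLIV) proves the 8-cell statement on its
`(p, r₁, r₂)`-box for EVERY `nn` with `nn·p ≥ (SS + SS1·p)/D` (no upper window end).  `coversE S fuel t B` checks computably that the k-d tree `t`
(the `BoxCover.Tree` of file XLV, leaves = one-element chains) covers the rational box `B` with checked `E`-free certificates containing their leaf
box and whose window start is `≤ S` at both `p`-ends of the leaf (affine in `p`, hence on the whole leaf).  `treeE_sound`: then the 8-cell statement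
holds for all `(p, r₁, r₂) ∈ B` with `0 < p`, `0 ≤ r₁ ≤ r₂ < 1` and ALL real `nn` with `nn·p ≥ S`.  The data files (`…EfreeData*`, generated by
`mktreeE.py`) state `BoxOKER S …` theorems per chunk via `boxOKE_of_coversE` + `boxOKER_of_boxOKE` and dispatch along the tree.
[this work].
-/

namespace Summit.CriticalPhenomena.PercolationContinuityZ3.Theorems

namespace Quant

namespace BoxCoverE

open BoxPoly BoxCert BoxCover

/-- The window of `c` starts at most at `nn·p = S` at parameter `p`: `SS + SS1·p ≤ S·D`. -/
def startLe (S : ℚ) (c : Cert) (p : ℚ) : Bool := decide ((c.SS : ℚ) + c.SS1 * p ≤ S * c.D)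

/-- An `E`-free leaf: exactly one certificate, checked (file XLIV), containing the box, open above (`efree`), window start `≤ S` at both `p`-ends. -/
def leafOkE (S : ℚ) (B : QBox) : List Cert → Bool
  | [c] => check c && certContains c B && c.efree && startLe S c B.plo && startLe S c B.phi
  | _ => false

/-- The tree `t` covers the box `B` with `E`-free certificates of window start `≤ S` (fuel recursion, for cheap kernel evaluation). -/
def coversE (S : ℚ) : ℕ → Tree → QBox → Bool
  | 0, _, _ => false
  | _ + 1, BoxCover.Tree.leaf chain, B => leafOkE S B chain
  | fuel + 1, BoxCover.Tree.node ax t tlo thi, B => coversE S fuel tlo (B.cut ax t true) && coversE S fuel thi (B.cut ax t false)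

/-- An `E`-free leaf proves the statement on its box for every `nn` with `nn·p ≥ S`. -/
theorem leaf_soundE (S : ℚ) (B : QBox) (c : Cert) (hok : leafOkE S B [c] = true) (p r₁ r₂ nn : ℝ)
    (hplo : (B.plo : ℝ) ≤ p) (hphi : p ≤ B.phi) (h1lo : (B.r1lo : ℝ) ≤ r₁) (h1hi : r₁ ≤ B.r1hi) (h2lo : (B.r2lo : ℝ) ≤ r₂) (h2hi : r₂ ≤ B.r2hi)
    (hp : 0 < p) (hr10 : 0 ≤ r₁) (hr12 : r₁ ≤ r₂) (hr2 : r₂ < 1) (hS : (S : ℝ) ≤ nn * p) :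
    ∀ (a0 a1 a2 b1 b2 c0 c1 d : ℝ), 0 ≤ a0 → 0 ≤ a1 → 0 ≤ a2 → 0 ≤ b1 → 0 ≤ b2 → 0 ≤ c0 → 0 ≤ c1 → 0 ≤ d →
    b1 * (b2 + (c0 + c1)) ≤ (a0 + a1 + a2) * d →
    b2 * (b1 + (c0 + c1)) ≤ (a0 + a1 + a2) * d →
    (c0 + c1) * (b1 + b2) ≤ (a0 + a1 + a2) * d →
    b1 * (a1 + a2 + c1 + d) ≤ d * (a0 + b1 + b2 + c0) →
    b2 * (a1 + a2 + c1 + d) ≤ d * (a0 + b1 + b2 + c0) →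
    c0 * (a1 + a2 + c1 + d) ≤ (c1 + d) * (a0 + b1 + b2 + c0) →
    0 < p * ((1 - r₁) * (1 - r₂)) * (a0 + c0) - (1 - p) * a2 - (1 - p) * ((1 - r₁) * (1 - r₂)) * d →
    0 < (1 - p) * (1 - r₁) * b1 - p * (r₂ * (1 - r₁)) * a0 - p * (1 - r₁) * a1 - (1 - p * r₁) * a2 - (1 - (1 - p) * (1 - r₂)) * (1 - r₁) * b2 - p * ((1 - r₁) * (1 - r₂)) * c1 →
    0 < (1 - p) * (1 - r₂) * b2 - p * (r₁ * (1 - r₂)) * a0 - p * (1 - r₂) * a1 - (1 - p * r₂) * a2 - (1 - (1 - p) * (1 - r₁)) * (1 - r₂) * b1 - p * ((1 - r₁) * (1 - r₂)) * c1 →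
    0 < (1 - p * max r₁ r₂ - nn * p * (1 - max r₁ r₂)) * a1 + (1 - p * (r₁ + r₂ * (1 - r₁)) - nn * p * ((1 - r₁) * (1 - r₂))) * c1 - nn * p * (r₁ + r₂ * (1 - r₁) - max r₁ r₂) * a0 - nn * ((1 - (1 - p) * (1 - r₁)) * (1 - r₂)) * b1 - nn * ((1 - (1 - p) * (1 - r₂)) * (1 - r₁)) * b2 →
    0 < (p * (1 + r₁ + r₂ + nn * max r₁ r₂) - 2) * a0 + (p * (1 + r₁ + r₂) + p * max r₁ r₂ * (nn - 1) - 1) * a1 + (p * (1 + r₁ + r₂) + nn - 2) * a2 + ((1 - (1 - p) * (1 - r₁)) * (1 + r₂ * (nn + 1)) - 1) * b1 + ((1 - (1 - p) * (1 - r₂)) * (1 + r₁ * (nn + 1)) - 1) * b2 + (p * (1 + (nn + 2) * (r₁ + r₂ * (1 - r₁))) - 2) * c0 + (p * (1 + (nn + 1) * (r₁ + r₂ * (1 - r₁))) - 1) * c1 + (nn + 1 - (1 - p) * ((1 - r₁) * (1 - r₂))) * d →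
    False := by
  simp only [leafOkE, Bool.and_eq_true] at hok
  obtain ⟨⟨⟨⟨hchk, hcont⟩, hE⟩, hslo⟩, hshi⟩ := hok
  have hD : (0 : ℝ) < c.D := by
    have := hcont
    simp only [certContains, Bool.and_eq_true, decide_eq_true_eq] at this
    exact_mod_cast this.1.1.1.1.1.1
  simp only [startLe, decide_eq_true_eq] at hslo hshi
  have hloR : (c.SS : ℝ) + (c.SS1 : ℝ) * (B.plo : ℝ) ≤ (S : ℝ) * c.D + 0 * (B.plo : ℝ) := by
    have := (Rat.cast_le (K := ℝ)).2 hslo; push_cast at this; linarith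
  have hhiR : (c.SS : ℝ) + (c.SS1 : ℝ) * (B.phi : ℝ) ≤ (S : ℝ) * c.D + 0 * (B.phi : ℝ) := by
    have := (Rat.cast_le (K := ℝ)).2 hshi; push_cast at this; linarith
  have hmid := affine_le_between _ _ _ _ _ _ p hloR hhiR hplo hphi
  have hwin : (c.SS : ℝ) + c.SS1 * p ≤ c.D * p * nn := by nlinarith [mul_le_mul_of_nonneg_left hS hD.le]
  exact cert_apply c B hchk hcont p r₁ r₂ nn hplo hphi h1lo h1hi h2lo h2hi hp hr10 hr12 hr2 (Or.inr hwin) (Or.inl hE)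

/-- **Coverage theorem (E-free).** -/
theorem treeE_sound (S : ℚ) : ∀ (fuel : ℕ) (t : Tree) (B : QBox), coversE S fuel t B = true → ∀ (p r₁ r₂ nn : ℝ),
    (B.plo : ℝ) ≤ p → p ≤ B.phi → (B.r1lo : ℝ) ≤ r₁ → r₁ ≤ B.r1hi → (B.r2lo : ℝ) ≤ r₂ → r₂ ≤ B.r2hi →
    0 < p → 0 ≤ r₁ → r₁ ≤ r₂ → r₂ < 1 → (S : ℝ) ≤ nn * p →
    ∀ (a0 a1 a2 b1 b2 c0 c1 d : ℝ), 0 ≤ a0 → 0 ≤ a1 → 0 ≤ a2 → 0 ≤ b1 → 0 ≤ b2 → 0 ≤ c0 → 0 ≤ c1 → 0 ≤ d →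
    b1 * (b2 + (c0 + c1)) ≤ (a0 + a1 + a2) * d →
    b2 * (b1 + (c0 + c1)) ≤ (a0 + a1 + a2) * d →
    (c0 + c1) * (b1 + b2) ≤ (a0 + a1 + a2) * d →
    b1 * (a1 + a2 + c1 + d) ≤ d * (a0 + b1 + b2 + c0) →
    b2 * (a1 + a2 + c1 + d) ≤ d * (a0 + b1 + b2 + c0) →
    c0 * (a1 + a2 + c1 + d) ≤ (c1 + d) * (a0 + b1 + b2 + c0) →
    0 < p * ((1 - r₁) * (1 - r₂)) * (a0 + c0) - (1 - p) * a2 - (1 - p) * ((1 - r₁) * (1 - r₂)) * d →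
    0 < (1 - p) * (1 - r₁) * b1 - p * (r₂ * (1 - r₁)) * a0 - p * (1 - r₁) * a1 - (1 - p * r₁) * a2 - (1 - (1 - p) * (1 - r₂)) * (1 - r₁) * b2 - p * ((1 - r₁) * (1 - r₂)) * c1 →
    0 < (1 - p) * (1 - r₂) * b2 - p * (r₁ * (1 - r₂)) * a0 - p * (1 - r₂) * a1 - (1 - p * r₂) * a2 - (1 - (1 - p) * (1 - r₁)) * (1 - r₂) * b1 - p * ((1 - r₁) * (1 - r₂)) * c1 →
    0 < (1 - p * max r₁ r₂ - nn * p * (1 - max r₁ r₂)) * a1 + (1 - p * (r₁ + r₂ * (1 - r₁)) - nn * p * ((1 - r₁) * (1 - r₂))) * c1 - nn * p * (r₁ + r₂ * (1 - r₁) - max r₁ r₂) * a0 - nn * ((1 - (1 - p) * (1 - r₁)) * (1 - r₂)) * b1 - nn * ((1 - (1 - p) * (1 - r₂)) * (1 - r₁)) * b2 →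
    0 < (p * (1 + r₁ + r₂ + nn * max r₁ r₂) - 2) * a0 + (p * (1 + r₁ + r₂) + p * max r₁ r₂ * (nn - 1) - 1) * a1 + (p * (1 + r₁ + r₂) + nn - 2) * a2 + ((1 - (1 - p) * (1 - r₁)) * (1 + r₂ * (nn + 1)) - 1) * b1 + ((1 - (1 - p) * (1 - r₂)) * (1 + r₁ * (nn + 1)) - 1) * b2 + (p * (1 + (nn + 2) * (r₁ + r₂ * (1 - r₁))) - 2) * c0 + (p * (1 + (nn + 1) * (r₁ + r₂ * (1 - r₁))) - 1) * c1 + (nn + 1 - (1 - p) * ((1 - r₁) * (1 - r₂))) * d →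
    False
  | 0, t, B, hcov => by simp [coversE] at hcov
  | fuel + 1, BoxCover.Tree.leaf chain, B, hcov => by
    intro p r₁ r₂ nn hplo hphi h1lo h1hi h2lo h2hi hp hr10 hr12 hr2 hS
    simp only [coversE] at hcov
    match chain, hcov with
    | [c], hcov => exact leaf_soundE S B c hcov p r₁ r₂ nn hplo hphi h1lo h1hi h2lo h2hi hp hr10 hr12 hr2 hS
    | [], hcov => simp [leafOkE] at hcov
    | _ :: _ :: _, hcov => simp [leafOkE] at hcov
  | fuel + 1, BoxCover.Tree.node ax t tlo thi, B, hcov => by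
    intro p r₁ r₂ nn hplo hphi h1lo h1hi h2lo h2hi hp hr10 hr12 hr2 hS
    simp only [coversE, Bool.and_eq_true] at hcov
    obtain ⟨hclo, hchi⟩ := hcov
    have ihlo := treeE_sound S fuel tlo (B.cut ax t true) hclo p r₁ r₂ nn
    have ihhi := treeE_sound S fuel thi (B.cut ax t false) hchi p r₁ r₂ nn
    rcases Nat.lt_or_ge ax 1 with hax | hax
    · have hax0 : ax = 0 := by omega
      subst hax0
      rcases le_total p (t : ℝ) with hle | hge
      · exact ihlo (by simpa [QBox.cut] using hplo) (by simpa [QBox.cut] using hle) (by simpa [QBox.cut] using h1lo)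
          (by simpa [QBox.cut] using h1hi) (by simpa [QBox.cut] using h2lo) (by simpa [QBox.cut] using h2hi) hp hr10 hr12 hr2 hS
      · exact ihhi (by simpa [QBox.cut] using hge) (by simpa [QBox.cut] using hphi) (by simpa [QBox.cut] using h1lo)
          (by simpa [QBox.cut] using h1hi) (by simpa [QBox.cut] using h2lo) (by simpa [QBox.cut] using h2hi) hp hr10 hr12 hr2 hS
    · rcases Nat.lt_or_ge ax 2 with hax1 | hax2
      · have hax1' : ax = 1 := by omega
        subst hax1'
        rcases le_total r₁ (t : ℝ) with hle | hge
        · exact ihlo (by simpa [QBox.cut] using hplo) (by simpa [QBox.cut] using hphi) (by simpa [QBox.cut] using h1lo)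
            (by simpa [QBox.cut] using hle) (by simpa [QBox.cut] using h2lo) (by simpa [QBox.cut] using h2hi) hp hr10 hr12 hr2 hS
        · exact ihhi (by simpa [QBox.cut] using hplo) (by simpa [QBox.cut] using hphi) (by simpa [QBox.cut] using hge)
            (by simpa [QBox.cut] using h1hi) (by simpa [QBox.cut] using h2lo) (by simpa [QBox.cut] using h2hi) hp hr10 hr12 hr2 hS
      · obtain ⟨m, hm⟩ : ∃ m, ax = m + 2 := ⟨ax - 2, by omega⟩
        subst hm
        rcases le_total r₂ (t : ℝ) with hle | hge
        · exact ihlo (by simpa [QBox.cut] using hplo) (by simpa [QBox.cut] using hphi) (by simpa [QBox.cut] using h1lo)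
            (by simpa [QBox.cut] using h1hi) (by simpa [QBox.cut] using h2lo) (by simpa [QBox.cut] using hle) hp hr10 hr12 hr2 hS
        · exact ihhi (by simpa [QBox.cut] using hplo) (by simpa [QBox.cut] using hphi) (by simpa [QBox.cut] using h1lo)
            (by simpa [QBox.cut] using h1hi) (by simpa [QBox.cut] using hge) (by simpa [QBox.cut] using h2hi) hp hr10 hr12 hr2 hS

/-- The 8-cell statement on the part `0 < p`, `0 ≤ r₁ ≤ r₂ < 1` of the rational box `B`, for every real `nn` with `nn·p ≥ S`. -/
def BoxOKE (S : ℚ) (B : QBox) : Prop := ∀ (p r₁ r₂ nn : ℝ),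
    (B.plo : ℝ) ≤ p → p ≤ B.phi → (B.r1lo : ℝ) ≤ r₁ → r₁ ≤ B.r1hi → (B.r2lo : ℝ) ≤ r₂ → r₂ ≤ B.r2hi →
    0 < p → 0 ≤ r₁ → r₁ ≤ r₂ → r₂ < 1 → (S : ℝ) ≤ nn * p →
    ∀ (a0 a1 a2 b1 b2 c0 c1 d : ℝ), 0 ≤ a0 → 0 ≤ a1 → 0 ≤ a2 → 0 ≤ b1 → 0 ≤ b2 → 0 ≤ c0 → 0 ≤ c1 → 0 ≤ d →
    b1 * (b2 + (c0 + c1)) ≤ (a0 + a1 + a2) * d →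
    b2 * (b1 + (c0 + c1)) ≤ (a0 + a1 + a2) * d →
    (c0 + c1) * (b1 + b2) ≤ (a0 + a1 + a2) * d →
    b1 * (a1 + a2 + c1 + d) ≤ d * (a0 + b1 + b2 + c0) →
    b2 * (a1 + a2 + c1 + d) ≤ d * (a0 + b1 + b2 + c0) →
    c0 * (a1 + a2 + c1 + d) ≤ (c1 + d) * (a0 + b1 + b2 + c0) →
    0 < p * ((1 - r₁) * (1 - r₂)) * (a0 + c0) - (1 - p) * a2 - (1 - p) * ((1 - r₁) * (1 - r₂)) * d →
    0 < (1 - p) * (1 - r₁) * b1 - p * (r₂ * (1 - r₁)) * a0 - p * (1 - r₁) * a1 - (1 - p * r₁) * a2 - (1 - (1 - p) * (1 - r₂)) * (1 - r₁) * b2 - p * ((1 - r₁) * (1 - r₂)) * c1 →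
    0 < (1 - p) * (1 - r₂) * b2 - p * (r₁ * (1 - r₂)) * a0 - p * (1 - r₂) * a1 - (1 - p * r₂) * a2 - (1 - (1 - p) * (1 - r₁)) * (1 - r₂) * b1 - p * ((1 - r₁) * (1 - r₂)) * c1 →
    0 < (1 - p * max r₁ r₂ - nn * p * (1 - max r₁ r₂)) * a1 + (1 - p * (r₁ + r₂ * (1 - r₁)) - nn * p * ((1 - r₁) * (1 - r₂))) * c1 - nn * p * (r₁ + r₂ * (1 - r₁) - max r₁ r₂) * a0 - nn * ((1 - (1 - p) * (1 - r₁)) * (1 - r₂)) * b1 - nn * ((1 - (1 - p) * (1 - r₂)) * (1 - r₁)) * b2 →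
    0 < (p * (1 + r₁ + r₂ + nn * max r₁ r₂) - 2) * a0 + (p * (1 + r₁ + r₂) + p * max r₁ r₂ * (nn - 1) - 1) * a1 + (p * (1 + r₁ + r₂) + nn - 2) * a2 + ((1 - (1 - p) * (1 - r₁)) * (1 + r₂ * (nn + 1)) - 1) * b1 + ((1 - (1 - p) * (1 - r₂)) * (1 + r₁ * (nn + 1)) - 1) * b2 + (p * (1 + (nn + 2) * (r₁ + r₂ * (1 - r₁))) - 2) * c0 + (p * (1 + (nn + 1) * (r₁ + r₂ * (1 - r₁))) - 1) * c1 + (nn + 1 - (1 - p) * ((1 - r₁) * (1 - r₂))) * d →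
    False

/-- A covered box satisfies `BoxOKE S`. -/
theorem boxOKE_of_coversE (S : ℚ) (fuel : ℕ) (t : Tree) (B : QBox) (h : coversE S fuel t B = true) : BoxOKE S B :=
  treeE_sound S fuel t B h

/-- The same statement with the threshold and the six box bounds as real parameters (the shape used by the dispatch theorems). -/
def BoxOKER (S plo phi r1lo r1hi r2lo r2hi : ℝ) : Prop := ∀ (p r₁ r₂ nn : ℝ),
    plo ≤ p → p ≤ phi → r1lo ≤ r₁ → r₁ ≤ r1hi → r2lo ≤ r₂ → r₂ ≤ r2hi →
    0 < p → 0 ≤ r₁ → r₁ ≤ r₂ → r₂ < 1 → S ≤ nn * p →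
    ∀ (a0 a1 a2 b1 b2 c0 c1 d : ℝ), 0 ≤ a0 → 0 ≤ a1 → 0 ≤ a2 → 0 ≤ b1 → 0 ≤ b2 → 0 ≤ c0 → 0 ≤ c1 → 0 ≤ d →
    b1 * (b2 + (c0 + c1)) ≤ (a0 + a1 + a2) * d →
    b2 * (b1 + (c0 + c1)) ≤ (a0 + a1 + a2) * d →
    (c0 + c1) * (b1 + b2) ≤ (a0 + a1 + a2) * d →
    b1 * (a1 + a2 + c1 + d) ≤ d * (a0 + b1 + b2 + c0) →
    b2 * (a1 + a2 + c1 + d) ≤ d * (a0 + b1 + b2 + c0) →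
    c0 * (a1 + a2 + c1 + d) ≤ (c1 + d) * (a0 + b1 + b2 + c0) →
    0 < p * ((1 - r₁) * (1 - r₂)) * (a0 + c0) - (1 - p) * a2 - (1 - p) * ((1 - r₁) * (1 - r₂)) * d →
    0 < (1 - p) * (1 - r₁) * b1 - p * (r₂ * (1 - r₁)) * a0 - p * (1 - r₁) * a1 - (1 - p * r₁) * a2 - (1 - (1 - p) * (1 - r₂)) * (1 - r₁) * b2 - p * ((1 - r₁) * (1 - r₂)) * c1 →
    0 < (1 - p) * (1 - r₂) * b2 - p * (r₁ * (1 - r₂)) * a0 - p * (1 - r₂) * a1 - (1 - p * r₂) * a2 - (1 - (1 - p) * (1 - r₁)) * (1 - r₂) * b1 - p * ((1 - r₁) * (1 - r₂)) * c1 →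
    0 < (1 - p * max r₁ r₂ - nn * p * (1 - max r₁ r₂)) * a1 + (1 - p * (r₁ + r₂ * (1 - r₁)) - nn * p * ((1 - r₁) * (1 - r₂))) * c1 - nn * p * (r₁ + r₂ * (1 - r₁) - max r₁ r₂) * a0 - nn * ((1 - (1 - p) * (1 - r₁)) * (1 - r₂)) * b1 - nn * ((1 - (1 - p) * (1 - r₂)) * (1 - r₁)) * b2 →
    0 < (p * (1 + r₁ + r₂ + nn * max r₁ r₂) - 2) * a0 + (p * (1 + r₁ + r₂) + p * max r₁ r₂ * (nn - 1) - 1) * a1 + (p * (1 + r₁ + r₂) + nn - 2) * a2 + ((1 - (1 - p) * (1 - r₁)) * (1 + r₂ * (nn + 1)) - 1) * b1 + ((1 - (1 - p) * (1 - r₂)) * (1 + r₁ * (nn + 1)) - 1) * b2 + (p * (1 + (nn + 2) * (r₁ + r₂ * (1 - r₁))) - 2) * c0 + (p * (1 + (nn + 1) * (r₁ + r₂ * (1 - r₁))) - 1) * c1 + (nn + 1 - (1 - p) * ((1 - r₁) * (1 - r₂))) * d →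
    False

/-- `BoxOKE S B` is `BoxOKER` of the cast threshold and bounds. -/
theorem boxOKER_of_boxOKE (S : ℚ) (B : QBox) (h : BoxOKE S B) : BoxOKER (S : ℝ) (B.plo : ℝ) B.phi B.r1lo B.r1hi B.r2lo B.r2hi :=
  h

end BoxCoverE

end Quant

end Summit.CriticalPhenomena.PercolationContinuityZ3.Theorems
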